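import Summits.BirchSwinnertonDyer.BirchSwinnertonDyer.Theses.SemiOrdinaryEisensteinDescent
import Summits.BirchSwinnertonDyer.BirchSwinnertonDyer.Theorems.EisensteinPrimesHidaLimitFittingBound
import Summits.BirchSwinnertonDyer.Rank1Residual.X11b.AnticyclotomicModuleFinite
import Summits.BirchSwinnertonDyer.Rank1Residual.X11b.HalvesReceptacle
import Literature.NumberTheory.EllipticCurves.SkinnerUrban2014.CharacteristicIdealBaseChangeProofs
import HarnessLib

/-!
# Crux E `WildSplitEisensteinInclusionAtThree` (stmt-BirchSwinnertonDyer-20479), line `birth`: the LEVER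
# `stub_semiOrdinaryTransferUpToPPower` in FITTING currency — a receptacle for an Eisenstein-congruence
# engine (cell `pub/bsd-wall`, width seat `bsd-wall-soed-p1-w3` g0, `--supports 20479`, helper)

The registered lever of line `birth` (skeleton sha16 4d547c0373835491 / v2 47fc36a48f6d3685) concludes, at a
frame `L ∈ R₀⟦T⟧` of `f_E` and the prime `𝔭′`, the Eisenstein inclusion UP TO A POWER OF `3`:
`∃ k, ∀ x ∈ Ch_Λ(X_(∅,0))·R₀⟦T⟧, 3^k·x ∈ (L)` (`X_(∅,0) = XAc (W.baseChange K) 3 κ 𝔭′ ∅ γ`, torsion guard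
among the binders). Eisenstein-congruence engines (Skinner–Urban §3 lattice construction, Wan arXiv:1412.1767,
Castella–Liu–Wan 2022 §8) bound Selmer groups from below through FITTING ideals of Galois-cohomology modules
(«the Eisenstein ideal contains `Fitt(𝒳)`») before passing to characteristic ideals. THIS FILE proves that,
for the lever, the two currencies agree up to the power of `3` the lever already allows:

* §1 (`Λ = ℤ_p⟦T⟧`, any prime `p`, any finitely generated torsion `Λ`-module `X`, any ring map
  `φ : Λ →+* S` into a commutative ring and any `L ∈ S`)
  `leverShape_of_fittingShape` — `(∃ k, ∀ x ∈ Fitt₀(X)·S, φ(p)^k·x ∈ (L)) → (∃ k, ∀ x ∈ Ch_Λ(X)·S, φ(p)^k·x ∈ (L))`: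
  `Ch_Λ(X) = (g)` is principal (`charIdeal_isPrincipal_holds`) and `p^a·g ∈ Fitt₀(X)` for some `a` (Keller–Yin
  Lemma 5.1.2 in the tree, `exists_span_C_pow_mul_span_le_fittingIdeal_zero`, bsd-eis), so `k + a` works;
  `fittingShape_of_leverShape` — the converse with the SAME `k`, from `Fitt₀(X) ⊆ Ch_Λ(X)`
  (`SkinnerUrban2014.fittingIdeal_zero_le_charIdeal`); `leverShape_iff_fittingShape`.
* §2 (the crux's objects at `p = 3`, `S = R₀⟦T⟧`, `φ = PowerSeries.map (toUnr 3)`, `φ(3) = 3`)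
  **`stub_semiOrdinaryTransferUpToPPower_of_fittingForm`** — the registered lever signature VERBATIM from the
  same statement with `Ch_Λ(X_(∅,0))` replaced by `Fitt₀(X_(∅,0))` (the «Fitting form» of the lever, displayed as
  the hypothesis `FittingForm` of the theorem, NOT a new definition); finite generation of `X_(∅,0)` is the tree
  theorem `AcSelmer.XAc.module_finite_empty`, torsion is the lever's own guard. So an engine may deliver
  `3^k·Fitt₀(X_(∅,0))·R₀⟦T⟧ ⊆ (L)` and the lever — hence, with p567302 (`μ(L) = 0` from Hsieh Thm. B by name) and
  p545527 (saturation), crux E — follows; and `fittingForm_of_stub_semiOrdinaryTransferUpToPPower` — conversely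
  the lever gives the Fitting form, so nothing is lost.

HONEST STATUS: a change of currency, not progress on the lever (no engine at a supercuspidal `π₃` exists in print:
lead soed-p1 g0's census, evidence LEVER-promote-stub.md on the item). No definition, no named fact, no `sorry`;
BSD is not proved for any curve. Supports, does not close, stmt-BirchSwinnertonDyer-20479.

References: [SkinnerUrban2014] §3.1.6, Cor. 3.2.9 (Fitting vs characteristic ideals); Keller–Yin, Lemma 5.1.2
(`p^a·char ⊆ Fitt₀` for torsion `Λ`-modules, tree theorem); [Washington1997] §13.2; folklore.
-/

set_option autoImplicit false
set_option linter.dupNamespace false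

noncomputable section

open scoped Classical

namespace Summit.BirchSwinnertonDyer.BirchSwinnertonDyer.Theorems.WildSplitEisensteinInclusionAtThreeLeverReceptacle

open PowerSeries Literature.RingTheory.FittingIdeal Literature.NumberTheory.EllipticCurves
  Summit.BirchSwinnertonDyer.Rank1Residual.X11b
  Summit.BirchSwinnertonDyer.BirchSwinnertonDyer.Theorems

/-! ### §1 Fitting currency ⟺ characteristic currency, up to a power of `p` -/

section Generic

universe v w

variable {p : ℕ} [Fact p.Prime] {X : Type v} [AddCommGroup X] [Module (IwasawaAlgebra p) X]
  [Module.Finite (IwasawaAlgebra p) X] {S : Type w} [CommRing S]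

/-- `PowerSeries.C (p : ℤ_p) = p` in `Λ`. [folklore] -/
theorem C_natCast_eq : (C (p : ℤ_[p]) : IwasawaAlgebra p) = (p : IwasawaAlgebra p) :=
  map_natCast C p

/-- **Fitting form ⟹ lever form.** For a finitely generated torsion `Λ`-module `X`, a ring map
`φ : Λ → S` and `L ∈ S`: if `φ(p)^k · Fitt₀(X)·S ⊆ (L)` for some `k`, then `φ(p)^{k'} · Ch_Λ(X)·S ⊆ (L)` for
some `k'` — `Ch_Λ(X) = (g)` (`charIdeal_isPrincipal_holds`) and `p^a g ∈ Fitt₀(X)` (Keller–Yin,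
`exists_span_C_pow_mul_span_le_fittingIdeal_zero`), take `k' = k + a`.
[cite: SkinnerUrban2014, §3.1.6 (p. 20)] -/
theorem leverShape_of_fittingShape (hX : Module.IsTorsion (IwasawaAlgebra p) X) (φ : IwasawaAlgebra p →+* S)
    (L : S)
    (h : ∃ k : ℕ, ∀ x ∈ (Module.fittingIdeal (IwasawaAlgebra p) X 0).map φ, φ p ^ k * x ∈ Ideal.span {L}) :
    ∃ k : ℕ, ∀ x ∈ (Module.charIdeal (IwasawaAlgebra p) X).map φ, φ p ^ k * x ∈ Ideal.span {L} := by
  obtain ⟨k, hk⟩ := h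
  obtain ⟨g, hg⟩ := (charIdeal_isPrincipal_holds p X).principal
  have hg' : Module.charIdeal (IwasawaAlgebra p) X = Ideal.span {g} := hg
  obtain ⟨a, ha⟩ := exists_span_C_pow_mul_span_le_fittingIdeal_zero X hX hg'
  -- `p^a g ∈ Fitt₀(X)`
  have hmem : (p : IwasawaAlgebra p) ^ a * g ∈ Module.fittingIdeal (IwasawaAlgebra p) X 0 := by
    refine ha ?_
    rw [Ideal.span_singleton_pow, Ideal.span_singleton_mul_span_singleton, C_natCast_eq]
    exact Ideal.mem_span_singleton_self _
  have hφmem : φ p ^ a * φ g ∈ (Module.fittingIdeal (IwasawaAlgebra p) X 0).map φ := by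
    have := Ideal.mem_map_of_mem φ hmem
    simpa [map_mul, map_pow, map_natCast] using this
  refine ⟨k + a, fun x hx ↦ ?_⟩
  rw [hg', Ideal.map_span, Set.image_singleton] at hx
  obtain ⟨c, rfl⟩ := Ideal.mem_span_singleton'.mp hx
  have hkey := hk _ hφmem
  -- `φ(p)^(k+a) · (c · φ g) = c · (φ(p)^k · (φ(p)^a · φ g))`
  have heq : φ p ^ (k + a) * (c * φ g) = c * (φ p ^ k * (φ p ^ a * φ g)) := by ring
  rw [heq]
  exact Ideal.mul_mem_left _ c hkey

/-- **Lever form ⟹ Fitting form** (same exponent): `Fitt₀(X) ⊆ Ch_Λ(X)` for a finitely generated module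
over the Noetherian UFD `Λ` (`SkinnerUrban2014.fittingIdeal_zero_le_charIdeal`).
[cite: SkinnerUrban2014, §3.1.6 (p. 20) and Cor. 3.2.9] -/
theorem fittingShape_of_leverShape (φ : IwasawaAlgebra p →+* S) (L : S)
    (h : ∃ k : ℕ, ∀ x ∈ (Module.charIdeal (IwasawaAlgebra p) X).map φ, φ p ^ k * x ∈ Ideal.span {L}) :
    ∃ k : ℕ, ∀ x ∈ (Module.fittingIdeal (IwasawaAlgebra p) X 0).map φ, φ p ^ k * x ∈ Ideal.span {L} := by
  obtain ⟨k, hk⟩ := h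
  exact ⟨k, fun x hx ↦ hk x (Ideal.map_mono (SkinnerUrban2014.fittingIdeal_zero_le_charIdeal) hx)⟩

/-- **The two currencies agree up to a power of `p`** (finitely generated torsion `X`). [folklore] -/
theorem leverShape_iff_fittingShape (hX : Module.IsTorsion (IwasawaAlgebra p) X)
    (φ : IwasawaAlgebra p →+* S) (L : S) :
    (∃ k : ℕ, ∀ x ∈ (Module.charIdeal (IwasawaAlgebra p) X).map φ, φ p ^ k * x ∈ Ideal.span {L}) ↔
      ∃ k : ℕ, ∀ x ∈ (Module.fittingIdeal (IwasawaAlgebra p) X 0).map φ, φ p ^ k * x ∈ Ideal.span {L} :=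
  ⟨fittingShape_of_leverShape φ L, leverShape_of_fittingShape hX φ L⟩

end Generic

/-! ### §2 The registered LEVER of line `birth` from its Fitting form -/

/-- `φ(3) = 3` for `φ = PowerSeries.map (toUnr 3) : Λ → R₀⟦T⟧`. [folklore] -/
theorem map_toUnr_natCast (p : ℕ) [Fact p.Prime] (n : ℕ) :
    PowerSeries.map (Halves.toUnr p) (n : IwasawaAlgebra p) = (n : UnrSeries p) :=
  map_natCast _ n

/-- **The LEVER ⟸ its FITTING FORM.** The registered signature of `stub_semiOrdinaryTransferUpToPPower`
(crux E, line `birth`, skeleton sha16 4d547c0373835491) VERBATIM as the conclusion; the hypothesis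
`FittingForm` is the same statement with the characteristic ideal `XAc.charIdeal` replaced by the Fitting
ideal `Fitt₀(X_(∅,0))` of the same `Λ`-module — the currency in which a lattice construction delivers.
`X_(∅,0)` is finitely generated (`AcSelmer.XAc.module_finite_empty`) and torsion by the lever's guard, so §1
applies with `k' = k + a`. [cite: SkinnerUrban2014, §3.1.6 (p. 20)] -/
theorem stub_semiOrdinaryTransferUpToPPower_of_fittingForm
    (FittingForm : ∀ (W : WeierstrassCurve ℚ) [W.IsElliptic] [W.IsGloballyMinimal] (N : ℕ) [NeZero N] (K : Type) [Field K] [NumberField K] (Dt : Literature.NumberTheory.EllipticCurves.ModularForms.ModularParametrizationData W N), Summit.BirchSwinnertonDyer.Rank1Residual.Additive.ClassO6 W 3 → W.HasSurjectiveModNGaloisRep 3 → W.analyticRank = 1 → W.conductorNorm ℤ = N → Literature.NumberTheory.EllipticCurves.IsImaginaryQuadratic K → Literature.NumberTheory.EllipticCurves.SatisfiesHeegnerHypothesis N K → ∀ (κ : Literature.NumberTheory.EllipticCurves.ZpExtension K 3), κ.IsAnticyclotomic → ∀ (γ : Field.absoluteGaloisGroup K) [Fact (κ.IsTopGenerator γ)]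 (𝔭 : IsDedekindDomain.HeightOneSpectrum (NumberField.RingOfIntegers K)), ((3 : ℕ) : NumberField.RingOfIntegers K) ∈ 𝔭.asIdeal → 𝔭.asIdeal.ramificationIdx (NumberField.RingOfIntegers ℚ) = 1 → 𝔭.asIdeal.inertiaDeg (NumberField.RingOfIntegers ℚ) = 1 → ∀ (𝔭' : IsDedekindDomain.HeightOneSpectrum (NumberField.RingOfIntegers K)), ((3 : ℕ) : NumberField.RingOfIntegers K) ∈ 𝔭'.asIdeal → 𝔭' ≠ 𝔭 → ∀ (ι' : PadicAlgCl 3 ≃+* ℂ), Summit.BirchSwinnertonDyer.BirchSwinnertonDyer.Theorems.SchneiderFree.BranchInducesPrime 3 ι' 𝔭 → ∀ (ΩK : ℂ) (Ωp : ℂ_[3]) (L : Literature.NumberTheory.EllipticCurves.UnrSeries 3), ΩK ≠ 0 → Ωp ≠ 0 → Literature.NumberTheory.EllipticCurves.IsBDPLFunction ι' 𝔭 κ γ Dt.f ΩK Ωp L → Module.IsTorsion (Literature.NumberTheory.EllipticCurves.IwasawaAlgebra 3) (Summit.BirchSwinnertonDyer.Rank1Residual.X11b.AcSelmer.XAc (W.baseChange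 K) 3 κ 𝔭' ∅ γ) → ∃ k : ℕ, ∀ x ∈ ((Module.fittingIdeal (Literature.NumberTheory.EllipticCurves.IwasawaAlgebra 3) (Summit.BirchSwinnertonDyer.Rank1Residual.X11b.AcSelmer.XAc (W.baseChange K) 3 κ 𝔭' ∅ γ) 0).map (PowerSeries.map (Summit.BirchSwinnertonDyer.Rank1Residual.X11b.Halves.toUnr 3))), (3 : Literature.NumberTheory.EllipticCurves.UnrSeries 3) ^ k * x ∈ Ideal.span {L}) :
    ∀ (W : WeierstrassCurve ℚ) [W.IsElliptic] [W.IsGloballyMinimal] (N : ℕ) [NeZero N] (K : Type) [Field K] [NumberField K] (Dt : Literature.NumberTheory.EllipticCurves.ModularForms.ModularParametrizationData W N), Summit.BirchSwinnertonDyer.Rank1Residual.Additive.ClassO6 W 3 → W.HasSurjectiveModNGaloisRep 3 → W.analyticRank = 1 → W.conductorNorm ℤ = N → Literature.NumberTheory.EllipticCurves.IsImaginaryQuadratic K → Literature.NumberTheory.EllipticCurves.SatisfiesHeegnerHypothesis N K → ∀ (κ : Literature.NumberTheory.EllipticCurves.ZpExtension K 3), κ.IsAnticyclotomic → ∀ (γ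 : Field.absoluteGaloisGroup K) [Fact (κ.IsTopGenerator γ)] (𝔭 : IsDedekindDomain.HeightOneSpectrum (NumberField.RingOfIntegers K)), ((3 : ℕ) : NumberField.RingOfIntegers K) ∈ 𝔭.asIdeal → 𝔭.asIdeal.ramificationIdx (NumberField.RingOfIntegers ℚ) = 1 → 𝔭.asIdeal.inertiaDeg (NumberField.RingOfIntegers ℚ) = 1 → ∀ (𝔭' : IsDedekindDomain.HeightOneSpectrum (NumberField.RingOfIntegers K)), ((3 : ℕ) : NumberField.RingOfIntegers K) ∈ 𝔭'.asIdeal → 𝔭' ≠ 𝔭 → ∀ (ι' : PadicAlgCl 3 ≃+* ℂ), Summit.BirchSwinnertonDyer.BirchSwinnertonDyer.Theorems.SchneiderFree.BranchInducesPrime 3 ι' 𝔭 → ∀ (ΩK : ℂ) (Ωp : ℂ_[3]) (L : Literature.NumberTheory.EllipticCurves.UnrSeries 3), ΩK ≠ 0 → Ωp ≠ 0 → Literature.NumberTheory.EllipticCurves.IsBDPLFunction ι' 𝔭 κ γ Dt.f ΩK Ωp L → Module.IsTorsion (Literature.NumberTheory.EllipticCurves.IwasawaAlgebra 3) (Summit.BirchSwinnertonDyer.Rank1Residual.X11b.AcSelmer.XAc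 (W.baseChange K) 3 κ 𝔭' ∅ γ) → ∃ k : ℕ, ∀ x ∈ ((Summit.BirchSwinnertonDyer.Rank1Residual.X11b.AcSelmer.XAc.charIdeal (W.baseChange K) 3 κ 𝔭' ∅ γ).map (PowerSeries.map (Summit.BirchSwinnertonDyer.Rank1Residual.X11b.Halves.toUnr 3))), (3 : Literature.NumberTheory.EllipticCurves.UnrSeries 3) ^ k * x ∈ Ideal.span {L} := by
  intro W _ _ N _ K _ _ Dt hO6 hsurj hr1 hN hK hH κ hκ γ _ 𝔭 h𝔭 he hf 𝔭' h𝔭' hne ι' hι ΩK Ωp L hΩK hΩp hL htor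
  haveI : Module.Finite (IwasawaAlgebra 3) (AcSelmer.XAc (W.baseChange K) 3 κ 𝔭' ∅ γ) :=
    AcSelmer.XAc.module_finite_empty κ 𝔭' γ
  have h := FittingForm W N K Dt hO6 hsurj hr1 hN hK hH κ hκ γ 𝔭 h𝔭 he hf 𝔭' h𝔭' hne ι' hι ΩK Ωp L hΩK hΩp hL
    htor
  have h3 : PowerSeries.map (Halves.toUnr 3) (3 : IwasawaAlgebra 3) = (3 : UnrSeries 3) := map_toUnr_natCast 3 3
  have h' := leverShape_of_fittingShape (p := 3) htor (PowerSeries.map (Halves.toUnr 3)) L (by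
    simpa only [Nat.cast_ofNat, h3] using h)
  simpa only [Nat.cast_ofNat, h3, AcSelmer.XAc.charIdeal] using h'

/-- **Conversely, the LEVER gives its Fitting form** (same `k`; `Fitt₀ ⊆ Ch`), so the Fitting currency loses
nothing. [cite: SkinnerUrban2014, §3.1.6 (p. 20)] -/
theorem fittingForm_of_stub_semiOrdinaryTransferUpToPPower
    (hLever : ∀ (W : WeierstrassCurve ℚ) [W.IsElliptic] [W.IsGloballyMinimal] (N : ℕ) [NeZero N] (K : Type) [Field K] [NumberField K] (Dt : Literature.NumberTheory.EllipticCurves.ModularForms.ModularParametrizationData W N), Summit.BirchSwinnertonDyer.Rank1Residual.Additive.ClassO6 W 3 → W.HasSurjectiveModNGaloisRep 3 → W.analyticRank = 1 → W.conductorNorm ℤ = N → Literature.NumberTheory.EllipticCurves.IsImaginaryQuadratic K → Literature.NumberTheory.EllipticCurves.SatisfiesHeegnerHypothesis N K → ∀ (κ : Literature.NumberTheory.EllipticCurves.ZpExtension K 3), κ.IsAnticyclotomic → ∀ (γ : Field.absoluteGaloisGroup K) [Fact (κ.IsTopGenerator γ)] (𝔭 : IsDedekindDomain.HeightOneSpectrum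 (NumberField.RingOfIntegers K)), ((3 : ℕ) : NumberField.RingOfIntegers K) ∈ 𝔭.asIdeal → 𝔭.asIdeal.ramificationIdx (NumberField.RingOfIntegers ℚ) = 1 → 𝔭.asIdeal.inertiaDeg (NumberField.RingOfIntegers ℚ) = 1 → ∀ (𝔭' : IsDedekindDomain.HeightOneSpectrum (NumberField.RingOfIntegers K)), ((3 : ℕ) : NumberField.RingOfIntegers K) ∈ 𝔭'.asIdeal → 𝔭' ≠ 𝔭 → ∀ (ι' : PadicAlgCl 3 ≃+* ℂ), Summit.BirchSwinnertonDyer.BirchSwinnertonDyer.Theorems.SchneiderFree.BranchInducesPrime 3 ι' 𝔭 → ∀ (ΩK : ℂ) (Ωp : ℂ_[3]) (L : Literature.NumberTheory.EllipticCurves.UnrSeries 3), ΩK ≠ 0 → Ωp ≠ 0 → Literature.NumberTheory.EllipticCurves.IsBDPLFunction ι' 𝔭 κ γ Dt.f ΩK Ωp L → Module.IsTorsion (Literature.NumberTheory.EllipticCurves.IwasawaAlgebra 3) (Summit.BirchSwinnertonDyer.Rank1Residual.X11b.AcSelmer.XAc (W.baseChange K) 3 κ 𝔭' ∅ γ) →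 ∃ k : ℕ, ∀ x ∈ ((Summit.BirchSwinnertonDyer.Rank1Residual.X11b.AcSelmer.XAc.charIdeal (W.baseChange K) 3 κ 𝔭' ∅ γ).map (PowerSeries.map (Summit.BirchSwinnertonDyer.Rank1Residual.X11b.Halves.toUnr 3))), (3 : Literature.NumberTheory.EllipticCurves.UnrSeries 3) ^ k * x ∈ Ideal.span {L}) :
    ∀ (W : WeierstrassCurve ℚ) [W.IsElliptic] [W.IsGloballyMinimal] (N : ℕ) [NeZero N] (K : Type) [Field K] [NumberField K] (Dt : Literature.NumberTheory.EllipticCurves.ModularForms.ModularParametrizationData W N), Summit.BirchSwinnertonDyer.Rank1Residual.Additive.ClassO6 W 3 → W.HasSurjectiveModNGaloisRep 3 → W.analyticRank = 1 → W.conductorNorm ℤ = N → Literature.NumberTheory.EllipticCurves.IsImaginaryQuadratic K → Literature.NumberTheory.EllipticCurves.SatisfiesHeegnerHypothesis N K → ∀ (κ : Literature.NumberTheory.EllipticCurves.ZpExtension K 3), κ.IsAnticyclotomic → ∀ (γ : Field.absoluteGaloisGroup K) [Fact (κ.IsTopGenerator γ)] (𝔭 : IsDedekindDomain.HeightOneSpectrum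 (NumberField.RingOfIntegers K)), ((3 : ℕ) : NumberField.RingOfIntegers K) ∈ 𝔭.asIdeal → 𝔭.asIdeal.ramificationIdx (NumberField.RingOfIntegers ℚ) = 1 → 𝔭.asIdeal.inertiaDeg (NumberField.RingOfIntegers ℚ) = 1 → ∀ (𝔭' : IsDedekindDomain.HeightOneSpectrum (NumberField.RingOfIntegers K)), ((3 : ℕ) : NumberField.RingOfIntegers K) ∈ 𝔭'.asIdeal → 𝔭' ≠ 𝔭 → ∀ (ι' : PadicAlgCl 3 ≃+* ℂ), Summit.BirchSwinnertonDyer.BirchSwinnertonDyer.Theorems.SchneiderFree.BranchInducesPrime 3 ι' 𝔭 → ∀ (ΩK : ℂ) (Ωp : ℂ_[3]) (L : Literature.NumberTheory.EllipticCurves.UnrSeries 3), ΩK ≠ 0 → Ωp ≠ 0 → Literature.NumberTheory.EllipticCurves.IsBDPLFunction ι' 𝔭 κ γ Dt.f ΩK Ωp L → Module.IsTorsion (Literature.NumberTheory.EllipticCurves.IwasawaAlgebra 3) (Summit.BirchSwinnertonDyer.Rank1Residual.X11b.AcSelmer.XAc (W.baseChange K) 3 κ 𝔭' ∅ γ) →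 ∃ k : ℕ, ∀ x ∈ ((Module.fittingIdeal (Literature.NumberTheory.EllipticCurves.IwasawaAlgebra 3) (Summit.BirchSwinnertonDyer.Rank1Residual.X11b.AcSelmer.XAc (W.baseChange K) 3 κ 𝔭' ∅ γ) 0).map (PowerSeries.map (Summit.BirchSwinnertonDyer.Rank1Residual.X11b.Halves.toUnr 3))), (3 : Literature.NumberTheory.EllipticCurves.UnrSeries 3) ^ k * x ∈ Ideal.span {L} := by
  intro W _ _ N _ K _ _ Dt hO6 hsurj hr1 hN hK hH κ hκ γ _ 𝔭 h𝔭 he hf 𝔭' h𝔭' hne ι' hι ΩK Ωp L hΩK hΩp hL htor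
  haveI : Module.Finite (IwasawaAlgebra 3) (AcSelmer.XAc (W.baseChange K) 3 κ 𝔭' ∅ γ) :=
    AcSelmer.XAc.module_finite_empty κ 𝔭' γ
  have h := hLever W N K Dt hO6 hsurj hr1 hN hK hH κ hκ γ 𝔭 h𝔭 he hf 𝔭' h𝔭' hne ι' hι ΩK Ωp L hΩK hΩp hL htor
  have h3 : PowerSeries.map (Halves.toUnr 3) (3 : IwasawaAlgebra 3) = (3 : UnrSeries 3) := map_toUnr_natCast 3 3
  have h' := fittingShape_of_leverShape (p := 3) (X := AcSelmer.XAc (W.baseChange K) 3 κ 𝔭' ∅ γ)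
    (PowerSeries.map (Halves.toUnr 3)) L (by simpa only [Nat.cast_ofNat, h3, AcSelmer.XAc.charIdeal] using h)
  simpa only [Nat.cast_ofNat, h3] using h'

end Summit.BirchSwinnertonDyer.BirchSwinnertonDyer.Theorems.WildSplitEisensteinInclusionAtThreeLeverReceptacle

end
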